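import Summits.QuantumFields.BalabanUV.Beta.GaugeMultiplierBlockMean
import Summits.QuantumFields.BalabanUV.Beta.AxialDressingRootedBmLinear
import Summits.QuantumFields.BalabanUV.Beta.AxialDressingRootedBridge

/-!
# `BalabanUV.Beta.GAN24.AxProjBmWindow` — binder row G-an2-4 / (CONV-C), S-slot on the literal of record (family (E), road «SREC»):
# THE BLOCK-MEAN-NORMALISED ROOTED PROJECTOR IS ITS WINDOW MATRIX — `Π^ρ_bm A = coProjBmW ρ N A` FOR EVERY 1-FORM (in-block root),
# hence the dressed `ℋ`-column of the (E) recursion is LITERALLY `Π_bm` of the undressed one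

NOT IN PRINT; OUR BOOKKEEPING (idle-seat piece «SREC-GAUGESTEP» = RULINGS-15b (R15-5) of the row owner `b2b-balaban-gan24-p1` gen 12, row V4-b of
`HOME/b2b-balaban-gan24-p1/PARTV-SREC-ROWS.md`; part 1 of 2, consumed by `GAN24/RespStepBmGaugeStep`).  HONEST FRAMING (cell contract, verbatim):
«discharging `BetaPertH` makes Bałaban's UV stability UNCONDITIONAL — a real constructive-QFT result; it is NOT the continuum limit and NOT the Clay
problem.»  HONEST DEPENDENCY (verbatim): «continuum YM on T⁴ ⇐ BetaPertH ∧ nine spine estimates (0/9 proved); BetaPertH ⇐ (D1) ∧ (D4) ∧ CAP+tail;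
G-an2-4 gates asym, D1 and NE2/3/4.»  [folklore] lattice bookkeeping over an2's block-mean dressing objects BY NAME (`AxialProjectorBlockMean.axProjBmAt`,
`AxialDressingRooted.pmBm` ∕ `bondInd` ∕ `cube` ∕ `coProjBmW` ∕ `colH_coDressKBmAt_eq` ∕ `sub_mem_cube_of_near` ∕ `mem_axial_hull` ∕ `axProjBmAt_mulLeft`,
`BorderedHessian.axProjBmAt_add` ∕ `axProjBmAtHom`), an1's `AveragingContoursRooted.treeGaugeAt` and `AxialProjector.blk_eq_of_mem_block`; generic dimension;
NO estimate, NO cited fact, NO `def`, NO `def … : Prop`, NO wall binder; reserved families untouched.  Discharges NOTHING of (hS, hSall) on (E); NOT D1,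
NOT BetaPertH, NOT continuum, NOT Clay.

## Why (SKELETON-SREC v0.2 SR-L4a, locator — not a premise)
Row SR-L4a decomposes the composed DRESSED legs of the (E) recursion as `T_{m→n} = Π_m ∘ respStep (Lc^m)(Lc^n) + dz ∘ Ψ_{m,n}`.  The legs are typed
through an2's WINDOW MATRIX `pmBm` (`colH (coDressKBmAt ρ N K) N μ y = coProjBmW ρ N (colH K N μ y)`, `colH_coDressKBmAt_eq`), while the gauge
mechanism is an OPERATOR law (`axProjBmAt_dz : Π_bm (dz f) = dz (blockMeanAt N f)`).  This file identifies the two for ALL 1-forms, so that every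
operator law of `Π_bm` applies verbatim to the dressed legs.

## Contents ([folklore]; in-block root `ρ = toSite r`, `r ∈ box`, `1 ≤ N`)
§1 LOCALITY: `treeGaugeAt_eq_zero_of_local` (a 1-form vanishing on the bonds based in the block of `x` has zero tree integral at `x` — the axial
   contour from the in-block root stays in the block, an2's `mem_axial_hull`), `blockMeanAt_treeGaugeAt_eq_zero_of_local`, **`axProjBmAt_eq_zero_of_local`** ∕
   **`axProjBmAt_congr_local`** (`Π^ρ_bm A (β, p)` reads `A` only on the bonds based in the blocks of `p` and `p + e_β`).
§2 THE MATRIX: `window_trunc_eq_sum` (the window truncation of `A` around `p` as a finite combination of bond indicators), **`axProjBmAt_eq_coProjBmW`** ∕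
   `axProjBmAt_eq_coProjBmW'` (`Π^ρ_bm A = coProjBmW ρ N A`: locality + additivity ∕ homogeneity on the window decomposition; the indicators' dressings
   ARE the matrix entries `pmBm` by definition), and **`colH_coDressKBmAt_eq_axProjBmAt`**: `colH (coDressKBmAt ρ N K) N μ y = Π^ρ_bm (colH K N μ y)`.
Unit `b2b-balaban-gan24-p4` (road P4 seat in custody, gen 27, taking the row owner's idle-seat invitation), 2026-08-20.
-/

noncomputable section

open Finset
open scoped BigOperators
open Literature.MathematicalPhysics.QuantumFieldTheory
open Literature.MathematicalPhysics.QuantumFieldTheory.Balaban1983to89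
open Literature.MathematicalPhysics.QuantumFieldTheory.Balaban1983to89.Beta
open AffineAveraging (Form0 Form1 Site box toSite unitVec unitVec_apply blockSum)
open AveragingContours (blk grad axial)
open AveragingContoursRooted (treeGaugeAt)
open AxialProjector (zsmul_blk_le lt_zsmul_blk_add blk_eq_of_mem_block)
open OneStepKernelFamily (colH)
open Summit.QuantumFields.BalabanUV.Beta.AxialProjectorBlockMean (blockMeanAt bmGaugeAt axProjBmAt)
open Summit.QuantumFields.BalabanUV.Beta.AxialDressingRooted (InHull mem_axial_hull pmBm bondInd bondInd_apply cube mem_cube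
  coProjBmW coProjBmW_apply coDressKBmAt colH_coDressKBmAt_eq sub_mem_cube_of_near axProjBmAt_mulLeft)
open Summit.QuantumFields.BalabanUV.Beta.BorderedHessian (axProjBmAt_add axProjBmAtHom axProjBmAtHom_apply)

namespace Summit.QuantumFields.BalabanUV.Beta.GAN24.AxProjBmWindow

variable {d : ℕ}

/-! ## §1 Locality of the block-mean-normalised rooted projector `Π^ρ_bm` (in-block root) -/

section Locality

variable {N : ℕ} {r : Fin (d + 1) → ℕ}

/-- [folklore] **THE ROOTED TREE INTEGRAL IS BLOCK-LOCAL** (in-block root `ρ = toSite r`): a 1-form vanishing on every bond whose base point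
lies in the block of `x` has vanishing tree integral at `x` — every letter of the axial contour from the block root to `x` is `±A κ z′` with `z′`
in the coordinatewise hull of the root and `x` (an2's `mem_axial_hull`), hence in the block. -/
theorem treeGaugeAt_eq_zero_of_local (hN : 1 ≤ N) (hr : r ∈ box (d + 1) N) {A : Form1 (d + 1) ℝ} {x : Site (d + 1)}
    (h : ∀ (κ : Fin (d + 1)) (z : Site (d + 1)), blk N z = blk N x → A κ z = 0) :
    treeGaugeAt (toSite r) A N x = 0 := by
  unfold treeGaugeAt
  refine List.sum_eq_zero fun a ha => ?_
  obtain ⟨κ, z', e, hz, -⟩ := mem_axial_hull ha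
  have hblk : blk N z' = blk N x := by
    refine blk_eq_of_mem_block hN (fun i => ?_) (fun i => ?_)
    · have hr0 : (0 : ℤ) ≤ (r i : ℕ) := by positivity
      have a1 := zsmul_blk_le hN x i
      have eroot : ((N : ℤ) • blk N x + toSite r) i = ((N : ℤ) • blk N x) i + ((r i : ℕ) : ℤ) := by
        simp only [Pi.add_apply, toSite]
      have b := (hz i).1
      have : min (((N : ℤ) • blk N x + toSite r) i) (x i) ≥ ((N : ℤ) • blk N x) i := le_min (by rw [eroot]; omega) a1
      omega
    · have hri : ((r i : ℕ) : ℤ) < N := by exact_mod_cast Finset.mem_range.1 (Fintype.mem_piFinset.1 hr i)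
      have a2 := lt_zsmul_blk_add hN x i
      have eroot : ((N : ℤ) • blk N x + toSite r) i = ((N : ℤ) • blk N x) i + ((r i : ℕ) : ℤ) := by
        simp only [Pi.add_apply, toSite]
      have b := (hz i).2
      have : max (((N : ℤ) • blk N x + toSite r) i) (x i) < ((N : ℤ) • blk N x) i + N := max_lt (by rw [eroot]; omega) a2
      omega
  rcases e with e | e
  · rw [e, h κ z' hblk]
  · rw [e, h κ z' hblk, neg_zero]

/-- [folklore] … hence so does its block mean (the block mean at `x` reads the tree integral at the points of the block of `x`). -/
theorem blockMeanAt_treeGaugeAt_eq_zero_of_local (hN : 1 ≤ N) (hr : r ∈ box (d + 1) N) {A : Form1 (d + 1) ℝ} {x : Site (d + 1)}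
    (h : ∀ (κ : Fin (d + 1)) (z : Site (d + 1)), blk N z = blk N x → A κ z = 0) :
    blockMeanAt N (treeGaugeAt (toSite r) A N) x = 0 := by
  unfold blockMeanAt blockSum
  rw [Finset.sum_eq_zero fun b hb => ?_, zero_div]
  exact treeGaugeAt_eq_zero_of_local hN hr fun κ z hz => h κ z (by rw [hz, AveragingContours.blk_block _ hb])

/-- [folklore] **LOCALITY OF `Π^ρ_bm` (FINITE RANGE, TWO BLOCKS)**: a 1-form vanishing on the bonds based in the blocks of `p` and of `p + e_β` has
vanishing dressing at `(β, p)` (`Π_bm A = A − grad (λ_A − blockMean λ_A)`). -/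
theorem axProjBmAt_eq_zero_of_local (hN : 1 ≤ N) (hr : r ∈ box (d + 1) N) {A : Form1 (d + 1) ℝ} {β : Fin (d + 1)} {p : Site (d + 1)}
    (h : ∀ (κ : Fin (d + 1)) (z : Site (d + 1)), blk N z = blk N p ∨ blk N z = blk N (p + unitVec β) → A κ z = 0) :
    axProjBmAt (toSite r) N A β p = 0 := by
  have h0 : ∀ (κ : Fin (d + 1)) (z : Site (d + 1)), blk N z = blk N p → A κ z = 0 := fun κ z hz => h κ z (Or.inl hz)
  have h1 : ∀ (κ : Fin (d + 1)) (z : Site (d + 1)), blk N z = blk N (p + unitVec β) → A κ z = 0 :=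
    fun κ z hz => h κ z (Or.inr hz)
  simp only [axProjBmAt, bmGaugeAt, grad, Pi.sub_apply]
  rw [treeGaugeAt_eq_zero_of_local hN hr h0, treeGaugeAt_eq_zero_of_local hN hr h1,
    blockMeanAt_treeGaugeAt_eq_zero_of_local hN hr h0, blockMeanAt_treeGaugeAt_eq_zero_of_local hN hr h1, h β p (Or.inl rfl)]
  ring

/-- [folklore] `Π^ρ_bm A (β, p)` depends on `A` only through the bonds based in the blocks of `p` and `p + e_β`. -/
theorem axProjBmAt_congr_local (hN : 1 ≤ N) (hr : r ∈ box (d + 1) N) {A A' : Form1 (d + 1) ℝ} {β : Fin (d + 1)} {p : Site (d + 1)}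
    (h : ∀ (κ : Fin (d + 1)) (z : Site (d + 1)), blk N z = blk N p ∨ blk N z = blk N (p + unitVec β) → A κ z = A' κ z) :
    axProjBmAt (toSite r) N A β p = axProjBmAt (toSite r) N A' β p := by
  have e : A = A' + (A - A') := by abel
  rw [e, axProjBmAt_add, Pi.add_apply, Pi.add_apply,
    axProjBmAt_eq_zero_of_local hN hr (A := A - A') (fun κ z hz => by rw [Pi.sub_apply, Pi.sub_apply, h κ z hz, sub_self]), add_zero]

end Locality

/-! ## §2 The projector IS its window matrix: `Π^ρ_bm A = coProjBmW ρ N A` for EVERY 1-form -/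

section Matrix

variable {N : ℕ} {r : Fin (d + 1) → ℕ}

/-- [folklore] The WINDOW TRUNCATION of a 1-form around the base point `p`: `A` on the bonds `(κ, p − v)`, `v ∈ cube`, zero elsewhere. -/
theorem window_trunc_eq_sum (p : Site (d + 1)) (A : Form1 (d + 1) ℝ) :
    (fun κ z => if p - z ∈ cube (d + 1) N then A κ z else 0)
      = fun κ z => ∑ v ∈ cube (d + 1) N, ∑ α : Fin (d + 1), A α (p - v) * (bondInd α (p - v) κ z : ℝ) := by
  funext κ z
  by_cases hz : p - z ∈ cube (d + 1) N
  · rw [if_pos hz]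
    rw [Finset.sum_eq_single_of_mem (p - z) hz (fun v _ hv => ?_)]
    · rw [sub_sub_cancel, Finset.sum_eq_single_of_mem κ (Finset.mem_univ κ) (fun α _ hα => ?_)]
      · simp [bondInd_apply]
      · rw [bondInd_apply, if_neg (fun hh => hα hh.1.symm), Int.cast_zero, mul_zero]
    · refine Finset.sum_eq_zero fun α _ => ?_
      rw [bondInd_apply, if_neg (fun hh => hv ?_), Int.cast_zero, mul_zero]
      rw [hh.2, sub_sub_cancel]
  · rw [if_neg hz]
    symm
    refine Finset.sum_eq_zero fun v hv => Finset.sum_eq_zero fun α _ => ?_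
    rw [bondInd_apply, if_neg (fun hh => hz ?_), Int.cast_zero, mul_zero]
    rw [hh.2, sub_sub_cancel]; exact hv

/-- [folklore] **`Π^ρ_bm` IS ITS WINDOW MATRIX** (in-block root, `N ≥ 1`): for EVERY 1-form `A` and every bond `(β, p)`,
`Π^ρ_bm A (β, p) = Σ_{v ∈ cube} Σ_α pmBm ρ N β p α (p − v) · A α (p − v) = coProjBmW ρ N A β p` — locality (§1: only the window is read,
an2's `sub_mem_cube_of_near`) and additivity ∕ homogeneity of `Π_bm` (an2's `axProjBmAtHom`, `axProjBmAt_mulLeft`) on the finite window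
decomposition into bond indicators, whose dressings are the matrix entries `pmBm` by definition.  The window operator of an2's dressing files
and the projector of the gauge laws (`axProjBmAt_dz`, `contourSum_axProjBmAt`) are ONE map. -/
theorem axProjBmAt_eq_coProjBmW (hN : 1 ≤ N) (hr : r ∈ box (d + 1) N) (A : Form1 (d + 1) ℝ) (β : Fin (d + 1)) (p : Site (d + 1)) :
    axProjBmAt (toSite r) N A β p = coProjBmW (toSite r) N A β p := by
  -- only the window is read
  have hloc : axProjBmAt (toSite r) N A β p
      = axProjBmAt (toSite r) N (fun κ z => if p - z ∈ cube (d + 1) N then A κ z else 0) β p := by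
    refine axProjBmAt_congr_local hN hr fun κ z hz => ?_
    have hw : z - p ∈ cube (d + 1) N := by
      rcases hz with hz | hz
      · exact sub_mem_cube_of_near hN (κ := κ) (Or.inl hz)
      · -- `blk z = blk (p + e_β)`: then `z - (p + e_β) ∈` the `(N-1)`-box, so `z - p ∈ cube`
        rw [mem_cube]
        intro i
        have a1 := zsmul_blk_le hN z i
        have a2 := lt_zsmul_blk_add hN z i
        have b1 := zsmul_blk_le hN (p + unitVec β) i
        have b2 := lt_zsmul_blk_add hN (p + unitVec β) i
        rw [hz] at a1 a2
        rw [Pi.add_apply, unitVec_apply] at b1 b2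
        rw [Pi.sub_apply, abs_le]
        by_cases hi : i = β
        · rw [if_pos hi] at b1 b2; constructor <;> omega
        · rw [if_neg hi] at b1 b2; constructor <;> omega
    have hw' : p - z ∈ cube (d + 1) N := by
      rw [mem_cube] at hw ⊢
      intro i
      rw [Pi.sub_apply, ← abs_neg, neg_sub]
      exact hw i
    rw [if_pos hw']
  rw [hloc, window_trunc_eq_sum, coProjBmW_apply]
  -- additivity and homogeneity on the finite decomposition
  rw [← axProjBmAtHom_apply, show (fun κ z => ∑ v ∈ cube (d + 1) N, ∑ α : Fin (d + 1), A α (p - v) * (bondInd α (p - v) κ z : ℝ))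
      = ∑ v ∈ cube (d + 1) N, ∑ α : Fin (d + 1), (fun κ z => A α (p - v) * (bondInd α (p - v) κ z : ℝ)) by
    funext κ z; simp only [Finset.sum_apply], map_sum]
  refine Finset.sum_congr rfl fun v _ => ?_
  rw [map_sum]
  refine Finset.sum_congr rfl fun α _ => ?_
  rw [axProjBmAtHom_apply, axProjBmAt_mulLeft, mul_comm]
  rfl

/-- [folklore] The same as an identity of 1-forms. -/
theorem axProjBmAt_eq_coProjBmW' (hN : 1 ≤ N) (hr : r ∈ box (d + 1) N) (A : Form1 (d + 1) ℝ) :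
    axProjBmAt (toSite r) N A = coProjBmW (toSite r) N A :=
  funext fun β => funext fun p => axProjBmAt_eq_coProjBmW hN hr A β p

/-- [folklore] **THE DRESSED `ℋ`-COLUMN IS `Π_bm` OF THE UNDRESSED ONE** (operator form of an2's `colH_coDressKBmAt_eq`):
`colH (coDressKBmAt ρ N K) N μ y = Π^ρ_bm (colH K N μ y)` — the one-step leg of the (E) recursion is the projector applied to an5's minimiser column. -/
theorem colH_coDressKBmAt_eq_axProjBmAt (hN : 1 ≤ N) (hr : r ∈ box (d + 1) N) (K : ExpKernelCalculus.MKer (d + 1) (OneStepResolventKernel.Fib d))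
    (μ : Fin (d + 1)) (y : Site (d + 1)) :
    colH (coDressKBmAt (toSite r) N K) N μ y = axProjBmAt (toSite r) N (colH K N μ y) := by
  rw [colH_coDressKBmAt_eq, axProjBmAt_eq_coProjBmW' hN hr]

end Matrix

end Summit.QuantumFields.BalabanUV.Beta.GAN24.AxProjBmWindow

end
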